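import Summits.Ventures.LatticeQCDFlow.Scaling.UnitSurvivalLogFloor
import Summits.Ventures.LatticeQCDFlow.Scaling.UnitSurvivalPZConstants

/-!
HONEST FRAMING: exact (Metropolis-corrected) sampling algorithms for lattice gauge theory; figures
of merit are autocorrelation/cost numbers at stated couplings and volumes; no continuum-physics
claim.

# UnitSurvivalKLogK — THE `K·log K` FLOOR IN THE CEILING'S UNIT: FOR THE IDEALISED HOT-ONLY STAR AT UNIFORM LISTING
# (`m = cK`, `K ≥ 8`, `|S| ≥ 20(K+1)`, EXACT HOT SAMPLER, `0 < t < 1`) `t_mix(1/4) ≥ (K/(t(1−t)) − 1)·log(K/32)` — WITH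
# THE CEILING `⌈((K+t)/(t(1−t)))·log(…)⌉` THE IDEALISED STAR MIXES IN `Θ((K/(t(1−t)))·log K)` STEPS (lean-2 GEN-27, ours)

Venture-side (OURS).  Cell `lqcd-flow` (pub-lqcd), unit `pub-lqcd-lean-2-g27`, 2026-08-27/28.  Chapter M, floor side,
file 7: the constant-chasing corollary of `Scaling/UnitSurvivalLogFloor` (`OPEN-MATH-chapterM.md` item 2, second-moment
part); the real-arithmetic constant chase is `Scaling/UnitSurvivalPZConstants.pzConstants_bound` (with `λ = t(1−t)/K`,
`κ₁ = t/K`, `K ≥ 8`, `(K+1)ν ≤ 1/20`, `(1−λ)ⁿK ≥ 32` the second-moment floor exceeds `1/4`).  §1 the generic lemma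
**`mixingTime_ge_KlogK_of_floor`** (`d(n) > 1/4` whenever `(1−λ)ⁿK ≥ 32` ⇒ `((1−λ)/λ)·log(K/32) ≤ t_mix(1/4)`);
§2 **`unitSurvival_worstTvDist_gt_quarter`** — every `n` with `(1−λ)ⁿK ≥ 32` has `d(n) > 1/4`;
**`idealStar_KlogK_floor`** — `t_mix(1/4) ≥ (K/(t(1−t)) − 1)·log(K/32)` (`|S| ≥ 20(K+1)` supplies the rare value `s`).  Reading (no numerics implied): with
`Scaling/IdealStarFourTermLaw`'s ceiling the idealised hot-only star at uniform listing obeys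
`(K/(t(1−t)) − 1)·log(K/32) ≤ t_mix(1/4) ≤ ((K+t)/(t(1−t)))·log(O(K²/t)) + 1` — order `(K/(t(1−t)))·log K` from both
sides, for every swap fraction `t`.  NOT CLAIMED: the sharp constant inside the logarithm; flow-assisted or rejected
swaps; anything measured.  Literature grade (cell rule): OWN RESULT (second-moment method); Mathlib only beyond the
chain; nothing cited as a fact; no new bib keys.
-/

noncomputable section

open Finset Function
open Literature.Probability.MarkovChains

namespace Summit.Ventures.LatticeQCDFlow.Scaling

/-! ## §1 The generic `K·log K` lemma -/

section Generic
variable {X : Type*} [Fintype X] [DecidableEq X]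

/-- **THE GENERIC `K·log K` LEMMA:** a row-stochastic `P` with stationary `π`, `0 < λ < 1`, `K > 0`; if `d(n) > 1/4`
whenever `(1−λ)ⁿK ≥ 32`, and `d(t₀) ≤ 1/4` at some time, then **`((1−λ)/λ)·log(K/32) ≤ t_mix(1/4)`** (the last
surviving time is `⌊log(K/32)/(−log(1−λ))⌋`, and `−log(1−λ) ≤ λ/(1−λ)`). [ours] -/
theorem mixingTime_ge_KlogK_of_floor {P : X → X → ℝ} (hP : IsRowStochastic P) {π : X → ℝ} (hst : IsStationary π P)
    {lam K : ℝ} (hlam0 : 0 < lam) (hlam1 : lam < 1) (hK0 : 0 < K)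
    (hfloor : ∀ n : ℕ, 32 ≤ (1 - lam) ^ n * K → 1 / 4 < worstTvDist P π n) (hmix : ∃ t₀, worstTvDist P π t₀ ≤ 1 / 4) :
    (1 - lam) / lam * Real.log (K / 32) ≤ (mixingTime P π (1 / 4) : ℝ) := by
  have h1lam : 0 < 1 - lam := by linarith
  -- the case `K ≤ 32` is trivial (the left side is non-positive)
  by_cases hK32 : K ≤ 32
  · have hlog : Real.log (K / 32) ≤ 0 :=
      Real.log_nonpos (div_nonneg hK0.le (by norm_num)) (by rw [div_le_one (by norm_num)]; exact hK32)
    exact (mul_nonpos_of_nonneg_of_nonpos (div_nonneg h1lam.le hlam0.le) hlog).trans (Nat.cast_nonneg _)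
  push Not at hK32
  -- the last time with `(1−λ)ⁿK ≥ 32`
  set n₀ : ℕ := ⌊Real.log (K / 32) / (-Real.log (1 - lam))⌋₊ with hn₀
  have hlogpos : 0 < Real.log (K / 32) := Real.log_pos (by rw [lt_div_iff₀ (by norm_num)]; linarith)
  have hneglog : 0 < -Real.log (1 - lam) := by
    have := Real.log_lt_sub_one_of_pos h1lam (by linarith); linarith
  have hn₀le : (n₀ : ℝ) ≤ Real.log (K / 32) / (-Real.log (1 - lam)) := Nat.floor_le (div_nonneg hlogpos.le hneglog.le)
  have hn₀ge : Real.log (K / 32) / (-Real.log (1 - lam)) - 1 ≤ n₀ := by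
    have := Nat.lt_floor_add_one (Real.log (K / 32) / (-Real.log (1 - lam)))
    rw [← hn₀] at this; linarith
  have hpow : 32 ≤ (1 - lam) ^ n₀ * K := by
    have h1 : (n₀ : ℝ) * (-Real.log (1 - lam)) ≤ Real.log (K / 32) := by
      rw [le_div_iff₀ hneglog] at hn₀le; exact hn₀le
    have h2 : Real.log 32 ≤ Real.log ((1 - lam) ^ n₀ * K) := by
      rw [Real.log_mul (pow_pos h1lam n₀).ne' hK0.ne', Real.log_pow]
      rw [Real.log_div hK0.ne' (by norm_num)] at h1
      linarith
    exact (Real.log_le_log_iff (by norm_num) (mul_pos (pow_pos h1lam n₀) hK0)).mp h2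
  -- `n₀ < t_mix(1/4)`: otherwise `d(n₀) ≤ 1/4`
  have hlt : n₀ < mixingTime P π (1 / 4) := by
    by_contra hle
    push Not at hle
    obtain ⟨t₀, ht₀⟩ := hmix
    have := worstTvDist_le_of_mixingTime_le hP hst ht₀ hle
    linarith [hfloor n₀ hpow]
  have hlt' := (Nat.cast_le (α := ℝ)).mpr (Nat.succ_le_of_lt hlt)
  push_cast at hlt'
  -- `−log(1−λ) ≤ λ/(1−λ)`
  have hlogle : -Real.log (1 - lam) ≤ lam / (1 - lam) := by
    have := Real.one_sub_inv_le_log_of_pos h1lam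
    have e : 1 - (1 - lam)⁻¹ = -(lam / (1 - lam)) := by field_simp; ring
    linarith
  have h3 : (1 - lam) / lam * Real.log (K / 32) ≤ Real.log (K / 32) / (-Real.log (1 - lam)) := by
    rw [le_div_iff₀ hneglog]
    have := mul_le_mul_of_nonneg_left hlogle (mul_nonneg (div_nonneg h1lam.le hlam0.le) hlogpos.le)
    have e : (1 - lam) / lam * Real.log (K / 32) * (lam / (1 - lam)) = Real.log (K / 32) := by
      field_simp
    linarith
  linarith

end Generic

/-! ## §2 The idealised hot-only star -/

section KLogK
variable {S : Type*} [Fintype S] [DecidableEq S] {K m : ℕ} {ν : S → ℝ} {M : Fin (K + 1) → S → S → ℝ} {t : ℝ}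
variable (κ : Fin m → Fin K)

/-- **SURVIVAL BEYOND `n`, AS A DISTANCE:** for the idealised hot-only star at uniform listing (`m = cK`, exact hot
sampler, any row-stochastic cold kernels, `0 < t < 1`, `K ≥ 8`), a state `s` with `(K+1)ν(s) ≤ 1/20`, a value `u ≠ s`,
and any `n` with `(1 − t(1−t)/K)ⁿ·K ≥ 32`: **`d(n) > 1/4`**. [ours] -/
theorem unitSurvival_worstTvDist_gt_quarter (hK : 8 ≤ K) (ht0 : 0 < t) (ht1 : t < 1) (hν : ∀ v, 0 < ν v)
    (hν1 : ∑ v, ν v = 1) (hM : ∀ k, IsRowStochastic (M k)) (hM0 : ∀ u v, M 0 u v = ν v) {c : ℕ} (hc1 : 1 ≤ c)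
    (hcu : ∀ p' : Fin K, (univ.filter (fun r : Fin m => κ r = p')).card = c) (hmc : m = c * K)
    (s u : S) (hus : u ≠ s) (hδ : ((K : ℝ) + 1) * ν s ≤ 1 / 20) {n : ℕ}
    (hn : 32 ≤ (1 - t * (1 - t) / K) ^ n * K) :
    1 / 4 < worstTvDist (fun y z : Fin (K + 1) → S => t * ptGraphSwap (fun _ : Fin (K + 1) => ν)
          (fun r : Fin m => (((0 : Fin (K + 1)), (κ r).succ) : Fin (K + 1) × Fin (K + 1))) (fun _ => Equiv.refl S) y z
        + (1 - t) * prodKernel (fun k : Fin (K + 1) => if k = 0 then (1 : ℝ) else 0) M y z)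
        (tensorFun (fun _ : Fin (K + 1) => ν)) n := by
  have hm : 1 ≤ m := by rw [hmc]; exact Nat.one_le_iff_ne_zero.mpr (Nat.mul_ne_zero (by omega) (by omega))
  have hcm : c ≤ m := by rw [hmc]; exact Nat.le_mul_of_pos_right c (by omega)
  have hKr : (8 : ℝ) ≤ K := by exact_mod_cast hK
  have hK0 : (0 : ℝ) < K := by linarith
  have hmR : (m : ℝ) = c * K := by rw [hmc, Nat.cast_mul]
  have hlamK : t * (1 - t) * c / m = t * (1 - t) / K := by rw [hmR]; field_simp
  have hkapK : t * c / m = t / K := by rw [hmR]; field_simp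
  have hsmall : 2 * t * (t * c / m) ≤ 1 - t * (1 - t) * c / m := by
    rw [hlamK, hkapK]
    have h1 : t * (t / K) ≤ 1 / 8 := by
      rw [← mul_div_assoc, div_le_iff₀ hK0]
      have : t * t ≤ 1 := by nlinarith
      linarith
    have h2 : t * (1 - t) / K ≤ 1 / 32 := by
      rw [div_le_iff₀ hK0]
      have : t * (1 - t) ≤ 1 / 4 := by nlinarith [sq_nonneg (t - 1 / 2)]
      linarith
    linarith
  have hfloor := unitSurvival_secondMoment_floor κ (by omega) hm ht0 ht1 hν hν1 hM hM0 hc1 hcu hcm s u hus rfl rfl hsmall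
    rfl rfl rfl rfl rfl rfl n
  rw [hlamK, hkapK] at hfloor
  have hconst := pzConstants_bound (K := (K : ℝ)) (νs := ν s) (n := n) ht0 ht1 hKr (hν s).le hδ rfl rfl rfl rfl rfl rfl
    rfl rfl hn
  exact lt_of_lt_of_le hconst hfloor

/-- **THE `K·log K` FLOOR IN THE CEILING'S UNIT: `t_mix(1/4) ≥ (K/(t(1−t)) − 1)·log(K/32)`** for the idealised hot-only
star at uniform listing (`m = cK`, exact hot sampler, `ν`-reversible kernels, `0 < t < 1`, `K ≥ 8`, `|S| ≥ 20(K+1)`,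
`1/4`-close at some time). [ours] -/
theorem idealStar_KlogK_floor (hK : 8 ≤ K) (hS : 20 * (K + 1) ≤ Fintype.card S) (ht0 : 0 < t) (ht1 : t < 1)
    (hν : ∀ v, 0 < ν v) (hν1 : ∑ v, ν v = 1) (hM : ∀ k, IsRowStochastic (M k)) (hMrev : ∀ k, DetailedBalance ν (M k))
    (hM0 : ∀ u v, M 0 u v = ν v) {c : ℕ} (hc1 : 1 ≤ c)
    (hcu : ∀ p' : Fin K, (univ.filter (fun r : Fin m => κ r = p')).card = c) (hmc : m = c * K)
    (hmix : ∃ t₀, worstTvDist (fun y z : Fin (K + 1) → S => t * ptGraphSwap (fun _ : Fin (K + 1) => ν)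
          (fun r : Fin m => (((0 : Fin (K + 1)), (κ r).succ) : Fin (K + 1) × Fin (K + 1))) (fun _ => Equiv.refl S) y z
        + (1 - t) * prodKernel (fun k : Fin (K + 1) => if k = 0 then (1 : ℝ) else 0) M y z)
        (tensorFun (fun _ : Fin (K + 1) => ν)) t₀ ≤ 1 / 4) :
    ((K : ℝ) / (t * (1 - t)) - 1) * Real.log (K / 32)
      ≤ (mixingTime (fun y z : Fin (K + 1) → S => t * ptGraphSwap (fun _ : Fin (K + 1) => ν)
          (fun r : Fin m => (((0 : Fin (K + 1)), (κ r).succ) : Fin (K + 1) × Fin (K + 1))) (fun _ => Equiv.refl S) y z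
        + (1 - t) * prodKernel (fun k : Fin (K + 1) => if k = 0 then (1 : ℝ) else 0) M y z)
        (tensorFun (fun _ : Fin (K + 1) => ν)) (1 / 4) : ℝ) := by
  have hKr : (8 : ℝ) ≤ K := by exact_mod_cast hK
  have hK0 : (0 : ℝ) < K := by linarith
  have h1t : 0 < 1 - t := by linarith
  have htt : 0 < t * (1 - t) := mul_pos ht0 h1t
  have hlam0 : 0 < t * (1 - t) / K := div_pos htt hK0
  have hlam1 : t * (1 - t) / K < 1 := by
    rw [div_lt_iff₀ hK0]; nlinarith [sq_nonneg (t - 1 / 2)]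
  -- a rare value `s` and a value `u ≠ s`
  have hSpos : 0 < Fintype.card S := by omega
  haveI : Nonempty S := Fintype.card_pos_iff.mp hSpos
  obtain ⟨s, hs⟩ := exists_rare_state (μ := fun _ : Fin (K + 1) => ν) (fun _ => hν1)
  have hcard : (0 : ℝ) < Fintype.card S := Nat.cast_pos.mpr hSpos
  have hS' : 20 * ((K : ℝ) + 1) ≤ Fintype.card S := by exact_mod_cast hS
  have hsum : ∑ _k : Fin (K + 1), ν s = ((K : ℝ) + 1) * ν s := by
    simp only [sum_const, card_univ, Fintype.card_fin, nsmul_eq_mul, Nat.cast_add, Nat.cast_one]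
  rw [hsum] at hs
  have hδ : ((K : ℝ) + 1) * ν s ≤ 1 / 20 := hs.trans (by rw [div_le_iff₀ hcard]; linarith)
  haveI hnt : Nontrivial S := by
    rw [← Fintype.one_lt_card_iff_nontrivial]; omega
  obtain ⟨u, hus⟩ := exists_ne s
  -- the scheme is a transition matrix with stationary law `ν^{⊗(K+1)}`
  have hμ' : ∀ (k : Fin (K + 1)) (v : S), 0 < (fun _ : Fin (K + 1) => ν) k v := fun _ v => hν v
  have hw0 : ∀ k : Fin (K + 1), 0 ≤ (if k = 0 then (1 : ℝ) else 0) := fun k => by split_ifs <;> norm_num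
  have hw1 : ∑ k : Fin (K + 1), (if k = 0 then (1 : ℝ) else 0) = 1 := by
    rw [Finset.sum_ite_eq' univ (0 : Fin (K + 1)), if_pos (mem_univ _)]
  have hPst := weightedScheme_isRowStochastic (t := t) (w := fun k : Fin (K + 1) => if k = 0 then (1 : ℝ) else 0)
    (ptGraphSwap_isRowStochastic (e := fun r : Fin m => (((0 : Fin (K + 1)), (κ r).succ) : Fin (K + 1) × Fin (K + 1)))
      (φ := fun _ => Equiv.refl S) hμ') hM hw0 hw1 ht0.le ht1.le
  have hst := (weightedScheme_detailedBalance (w := fun k : Fin (K + 1) => if k = 0 then (1 : ℝ) else 0)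
    (ptGraphSwap_detailedBalance (e := fun r : Fin m => (((0 : Fin (K + 1)), (κ r).succ) : Fin (K + 1) × Fin (K + 1)))
      (φ := fun _ => Equiv.refl S) hμ') (fun k => hMrev k) t).isStationary hPst.2
  have h := mixingTime_ge_KlogK_of_floor hPst hst hlam0 hlam1 hK0
    (fun n hn => unitSurvival_worstTvDist_gt_quarter κ hK ht0 ht1 hν hν1 hM hM0 hc1 hcu hmc s u hus hδ hn) hmix
  have hcoef : (K : ℝ) / (t * (1 - t)) - 1 = (1 - t * (1 - t) / K) / (t * (1 - t) / K) := by field_simp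
  rw [hcoef]
  exact h

end KLogK

end Summit.Ventures.LatticeQCDFlow.Scaling

end
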